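import Summits.QuantumFields.BalabanUV.T4Continuum.Support.NE7ConvOneStepTangent
import Summits.QuantumFields.BalabanUV.T4Continuum.Support.NE7ConvOneStepUnique
import Summits.QuantumFields.BalabanUV.T4Continuum.Support.NE7EtaMinimiserGaugeCovariance
import HarnessLib

/-!
# NE7ConvOneStepWeightedUnique — AT MOST ONE MINIMAL ORBIT IN THE WEIGHTED TANGENT CURRENCY, and «EVERY COMPETITOR DOING AT LEAST AS WELL AS THE
# SMALL CRITICAL CONFIGURATION IS AS SMALL» (the letter ALL-SMALL of the minimisation road to (OPEN)) from REP_w WITH THE GAUGE IDENTITY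

Cell `pub-balaban`, rung (B)+1 sub-cell t4, lineage `b2b-balaban-t4-ne7-p1`, generation 68 (CRUX PROVER NE7 #1); hunt (h12) «(OPEN) BY MINIMISATION:
IFT leaves the bill», memo `t4/b2b-balaban-t4-ne7-p1-g68/HUNT-H12-OPEN-BY-MINIMISATION.md` §2.  File F26 (over F6 `NE7ConvOneStepUnique`, F9
`NE7ConvOneStepWeighted`, F19 `NE7ConvOneStepTangent`, [tree] `NE7EtaMinimiserGaugeCovariance` ∕ `BlockAverageCurrent.smallField_gaugeAct`).

WHY.  Gen 67 left ONE-STEP ⇐ OPEN ∧ REP_w with OPEN = APE ∧ IFT (F24).  Gen 68 replaces the implicit-function continuation (IFT) by MINIMISATION: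
near a parameter `τ₀` carrying a small critical configuration `U₀`, global minimisers exist (compactness, [tree] `MinimalActionExistence`), stay close to the
set of minimisers at `τ₀` (Berge), and are therefore small — PROVIDED every minimiser at `τ₀` is small.  That proviso is UNIQUENESS of the minimal orbit,
which is the STRICT form of CONV: this file.
WHAT ([folklore]; 0 def, 0 sorry).
§1 **`energyNormW_sq_eq_zero_of_slop`** — F6's `dirSq_eq_zero_of_poincare_slop` in F9's weighted currency: unitary `U`, skew `M`-periodic `X` with `‖X‖_∞ ≤ α`,
   a weighted Poincaré letter `m·‖X‖_w² ≤ curlSq U X`, radius `a′` along the segment, slop `−κ·‖X‖_w² ≤ dAction U X`, the STRICT line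
   `2κ < (m∕2 − 576d(e^α−1)²(L^k)²)∕card n − 28d·a′·(L^k)²` and `A(U e^X) ≤ A(U)` ⟹ `‖X‖_w² = 0`; **`eq_zero_of_energyNormW_sq_eq_zero`** ⟹ `X = 0` (`L ≥ 1`).
§2 **`vary_eq_self_of_tanCritical_repW`** — AT MOST ONE MINIMAL ORBIT modulo REP_w: `U♯ ∈ admissible (sfClass d L N ε) L (k+1) V` critical on the tangent
   space `T(U♯)`, (P♮)_W on the class with constant `CP`, a competitor `U′` with `levelAction U′ ≤ levelAction U♯` represented by `X = X_T + X_N` with F9's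
   weighted letters (`ν`, `κ₁`) under the STRICT line `2κ₁ < …` ⟹ `X = 0 ∧ U♯e^X = U♯`.
§3 **`smallField_of_le_of_repW_gauge`** — ALL-SMALL: if moreover the representation carries the GAUGE IDENTITY `U′^u = U♯e^X` (`u` unitary; [Balaban1985Variational]
   Prop. 2 ∕ B8 Thm 2 TYPE — the honest form of REP), then `SmallField U♯ r₁ ⟹ SmallField U′ r₁`; **`allSmall_of_tanCritical_repW_gauge`** — the class form
   consumed by F27: every admissible `U′` with `levelAction U′ ≤ levelAction U♯` is `SmallField · r₁`.
HONEST FRAMING (page 1): convexity bookkeeping over HYPOTHESES (REP_w with the gauge identity, tangent criticality, (P♮)_W); nothing is asserted about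
Bałaban's minimisers; NOT ONE-STEP, NOT NE7; spine 0∕9; finite T⁴ rung (B)+1 — NOT infinite volume, NOT mass gap, NOT Clay.  Continuum YM on T⁴ ⇐
BetaPertH ∧ nine spine estimates (0/9 proved); BetaPertH ⇐ (D1) ∧ (D4) ∧ CAP+tail; G-an2-4 gates asym, D1 and NE2/3/4.
-/

set_option autoImplicit false

open scoped BigOperators Matrix.Norms.L2Operator
open NormedSpace Finset Set

namespace Summit.QuantumFields.BalabanUV.T4Continuum.NE7ConvOneStepWeightedUnique

open Literature.MathematicalPhysics.QuantumFieldTheory.Balaban1983to89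
open B7Prop1Explicit B7Prop2Explicit MatrixLog UnitaryModel
open T4AveragingDeficitWall (IsUnitaryCfg IsSkewDir SmallField fineAction vary curl curlSq dirSq vary_zero_dir)
open T4AveragingDeficitWallBoundary (IsPeriodicCfg periodBox)
open AveragingDeficitPeriodicCounting (IsPeriodicDir)
open AveragingDeficitKDatum (gaugeAct_inv_gaugeAct)
open AveragingDeficitMultiLevelPrep (TangentIter)
open AveragingDeficitMultiLevelBridge (tower_eq)
open MinimalActionLevels (levelAction perWin stepWt stepWt_pos)
open MinimalActionSandwich (IsMinimiser admissible)
open MinimalActionRate (sfClass)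
open NE3HessForm (hess dAction)
open NE3HessShapes (plaqsOf)
open NE3SlicePoincareShape (SlicePoincare)
open NE3FrameFreeSliceW (frameFreeBlockLandauW)
open NE3EnergyWeightedShapes (energyNormW energyNormW_nonneg)
open NE3WeightedCoercivityTransfer (energyNormW_sq)
open NE3EnergyHessContTwoTerm (curlSq_nonneg dirSq_nonneg)
open NE3EnergyShapes (IsUnitarySite)
open NE7SegmentPlaquetteRadius (smallField_vary_segment_class)
open NE7OneStepLetters (dAction_ge_of_tangent_critical)
open NE7ConvOneStepUnique (fineAction_vary_sub_ge eq_zero_of_dirSq_eq_zero)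
open NE7ConvOneStepWeighted (curlSq_ge_weighted hess_vary_ge_weighted)
open NE7EtaMinimiserGaugeCovariance (levelAction_gaugeAct isUnitarySite_inv)
open BlockAverageCurrent (smallField_gaugeAct)

noncomputable section

variable {d : ℕ} {n : Type*} [Fintype n] [DecidableEq n]

/-! ## §1 Strict convexity in the weighted currency: a non-increasing competitor has the zero direction -/

/-- **`‖X‖_w² = 0` FOR A COMPETITOR THAT DOES NOT INCREASE THE ACTION, UNDER THE STRICT WEIGHTED LINE.**  `L ≥ 1`, unitary `U`, skew `M`-periodic `X`
(`M ≥ 1`) with `‖X(b)‖ ≤ α` (`α ≥ 0`), weighted Poincaré letter `m·‖X‖_w² ≤ curlSq U X`, radius `a′ ≥ 0` of `U e^{tX}` on `[0,1]`, slop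
`−κ·‖X‖_w² ≤ dAction U X` on `plaqsOf (periodBox M)`, the STRICT line `2κ < (m∕2 − 576d(e^α − 1)²(L^k)²)∕card n − 28d·a′·(L^k)²`, and
`A(U e^{X}) ≤ A(U)` on that window ⟹ `energyNormW L k U X (periodBox M)² = 0`. [folklore] -/
theorem energyNormW_sq_eq_zero_of_slop [Nonempty n] {L k M : ℕ} (hL : 1 ≤ L) (hM : 1 ≤ M) {U : Site d → Fin d → (Matrix n n ℂ)ˣ}
    (hU : IsUnitaryCfg U) {X : Site d → Fin d → Matrix n n ℂ} (hX : IsSkewDir X) (hXP : IsPeriodicDir X M) {α m a' κ : ℝ} (hα : 0 ≤ α)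
    (hXα : ∀ x μ, ‖X x μ‖ ≤ α) (hm : m * energyNormW L k U X (periodBox (d := d) M) ^ 2 ≤ curlSq U X (periodBox (d := d) M))
    (ha' : 0 ≤ a') (hrad : ∀ t ∈ Icc (0 : ℝ) 1, SmallField (vary U X t) a')
    (hslop : -(κ * energyNormW L k U X (periodBox (d := d) M) ^ 2) ≤ dAction U X (plaqsOf (periodBox (d := d) M)))
    (hline : 2 * κ < (m / 2 - 576 * d * (Real.exp α - 1) ^ 2 * ((L : ℝ) ^ k) ^ 2) / (Fintype.card n : ℝ) - 28 * d * a' * ((L : ℝ) ^ k) ^ 2)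
    (hle : fineAction (vary U X 1) (plaqsOf (periodBox (d := d) M)) ≤ fineAction U (plaqsOf (periodBox (d := d) M))) :
    energyNormW L k U X (periodBox (d := d) M) ^ 2 = 0 := by
  set E := energyNormW L k U X (periodBox (d := d) M) ^ 2 with hE
  set cX := (m / 2 - 576 * d * (Real.exp α - 1) ^ 2 * ((L : ℝ) ^ k) ^ 2) / (Fintype.card n : ℝ) - 28 * d * a' * ((L : ℝ) ^ k) ^ 2 with hcX
  have hE0 : 0 ≤ E := by rw [hE]; exact sq_nonneg _
  have hconv : ∀ t ∈ Icc (0 : ℝ) 1, cX * E ≤ hess (vary U X t) X X (plaqsOf (periodBox (d := d) M)) :=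
    fun t ht => hess_vary_ge_weighted hL hM hU hX hXP hα hXα hm ht ha' (hrad t ht)
  have hgap := fineAction_vary_sub_ge U X (plaqsOf (periodBox (d := d) M)) hconv hslop
  -- `(cX∕2 − κ)·E ≤ A(Ue^X) − A(U) ≤ 0` with `cX∕2 − κ > 0`
  have hpos : 0 < cX / 2 - κ := by linarith
  have hprod : (cX / 2 - κ) * E ≤ 0 := by nlinarith
  have hEle : E ≤ 0 := by
    by_contra hcon
    have := mul_pos hpos (not_le.mp hcon)
    linarith
  linarith

/-- **A periodic direction with zero weighted energy vanishes**: `L ≥ 1`, `M ≥ 1`, `X` `M`-periodic with `energyNormW L k U X (periodBox M)² = 0` ⟹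
`X = 0` (the `(L^k)^{−2}·dirSq` summand vanishes; `NE7ConvOneStepUnique.eq_zero_of_dirSq_eq_zero`). [folklore] -/
theorem eq_zero_of_energyNormW_sq_eq_zero {L k M : ℕ} (hL : 1 ≤ L) (hM : 1 ≤ M) (U : Site d → Fin d → (Matrix n n ℂ)ˣ)
    {X : Site d → Fin d → Matrix n n ℂ} (hXP : IsPeriodicDir X M) (h0 : energyNormW L k U X (periodBox (d := d) M) ^ 2 = 0) :
    X = fun _ _ => 0 := by
  rw [energyNormW_sq] at h0
  have hC : 0 ≤ curlSq U X (periodBox (d := d) M) := curlSq_nonneg _ _ _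
  have hD : 0 ≤ dirSq X (periodBox (d := d) M) := dirSq_nonneg _ _
  have hLk : (0 : ℝ) < (L : ℝ) ^ k := pow_pos (by exact_mod_cast (show 0 < L by omega)) k
  have hw : 0 < (((L : ℝ) ^ k)⁻¹) ^ 2 := by positivity
  have hwD : 0 ≤ (((L : ℝ) ^ k)⁻¹) ^ 2 * dirSq X (periodBox (d := d) M) := mul_nonneg hw.le hD
  have hD0 : (((L : ℝ) ^ k)⁻¹) ^ 2 * dirSq X (periodBox (d := d) M) = 0 := by linarith
  have hD0' : dirSq X (periodBox (d := d) M) = 0 := by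
    rcases mul_eq_zero.mp hD0 with h | h
    · exact absurd h hw.ne'
    · exact h
  exact eq_zero_of_dirSq_eq_zero hM hXP hD0'

/-! ## §2 At most one minimal orbit modulo REP_w (tangent currency, class Poincaré) -/

/-- **AT MOST ONE MINIMAL ORBIT MODULO REP_w** (the minimiser half of [Balaban1985Variational] Prop. 7 in the dictionary, weighted tangent currency).
`U♯ ∈ admissible (sfClass d L N ε) L (k+1) V` (`L, N ≥ 1`, `ε ≥ 0`) critical on the tangent space `T(U♯)`, (P♮)_W on the class with constant `CP > 0`;
a competitor `U′` with `levelAction U′ ≤ levelAction U♯` REPRESENTED over `U♯` by a skew `(N·L^{k+1})`-periodic `X` (`‖X‖_∞ ≤ α`,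
`levelAction (U♯e^X) ≤ levelAction U′`, `SmallField (U♯e^X) (ε(L^{k+1})^{−2})`, split `X = X_T + X_N`, `X_T ∈ T_♮(U♯)`, F9's weighted letters `ν`, `κ₁`)
under the STRICT line ⟹ `X = 0` and `U♯e^{X} = U♯`. [folklore] -/
theorem vary_eq_self_of_tanCritical_repW [Nonempty n] {L N k : ℕ} [NeZero L] [NeZero N] (hL : 1 ≤ L) (hN : 1 ≤ N) {ε CP : ℝ}
    (hε : 0 ≤ ε) (hCP : 0 < CP)
    (hP : ∀ (j : ℕ) (W : Site d → Fin d → (Matrix n n ℂ)ˣ), W ∈ sfClass d L N ε (j + 1) →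
      SlicePoincare L (j + 1) W (frameFreeBlockLandauW L N (j + 1) W) CP (periodBox (d := d) (N * L ^ (j + 1))))
    {V Us U' : Site d → Fin d → (Matrix n n ℂ)ˣ} (hmem : Us ∈ admissible (sfClass d L N ε) L (k + 1) V)
    (hcritT : ∀ φ : Site d → Fin d → Matrix n n ℂ, IsSkewDir φ → IsPeriodicDir φ ((N * L ^ (k + 1) : ℕ) : ℤ) → TangentIter L k Us φ →
      dAction Us φ (perWin d (N * L ^ (k + 1))) = 0)
    (hmin' : levelAction d L N (k + 1) U' ≤ levelAction d L N (k + 1) Us)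
    {X XT XN : Site d → Fin d → Matrix n n ℂ} {α ν κ₁ : ℝ} (hXs : IsSkewDir X) (hXP : IsPeriodicDir X ((N * L ^ (k + 1) : ℕ) : ℤ))
    (hα : 0 ≤ α) (hXα : ∀ x μ, ‖X x μ‖ ≤ α) (hle : levelAction d L N (k + 1) (vary Us X 1) ≤ levelAction d L N (k + 1) U')
    (h1 : SmallField (vary Us X 1) (ε / ((L : ℝ) ^ (k + 1)) ^ 2)) (hsplit : X = XT + XN)
    (hXT : XT ∈ frameFreeBlockLandauW (d := d) (n := n) L N (k + 1) Us) (hXNs : IsSkewDir XN)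
    (hNw : energyNormW L (k + 1) Us XN (periodBox (d := d) (N * L ^ (k + 1)))
      ≤ ν * energyNormW L (k + 1) Us X (periodBox (d := d) (N * L ^ (k + 1))))
    (hN1 : ε / ((L : ℝ) ^ (k + 1)) ^ 2 * (∑ p ∈ perWin d (N * L ^ (k + 1)), ‖curl Us XN p‖)
      ≤ κ₁ * energyNormW L (k + 1) Us X (periodBox (d := d) (N * L ^ (k + 1))) ^ 2)
    (hline : 2 * κ₁ < ((((1 / 2 - ν ^ 2) / (2 * (1 + CP)) - ν ^ 2) / 2
        - 576 * d * (Real.exp α - 1) ^ 2 * ((L : ℝ) ^ (k + 1)) ^ 2) / (Fintype.card n : ℝ)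
        - 28 * d * (ε / ((L : ℝ) ^ (k + 1)) ^ 2 + 7 * α ^ 2) * ((L : ℝ) ^ (k + 1)) ^ 2)) :
    X = (fun _ _ => 0) ∧ vary Us X 1 = Us := by
  have hN0 : 0 < N := hN
  have hL0 : 0 < L := hL
  have hM : 1 ≤ N * L ^ (k + 1) := Nat.mul_pos hN0 (Nat.pow_pos hL0)
  have e : perWin d (N * L ^ (k + 1)) = plaqsOf (periodBox (d := d) (N * L ^ (k + 1))) := rfl
  set a : ℝ := ε / ((L : ℝ) ^ (k + 1)) ^ 2 with hadef
  have ha : 0 ≤ a := by rw [hadef]; positivity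
  have hUs : IsUnitaryCfg Us := hmem.1.1
  have hUsa : SmallField Us a := hmem.1.2.2
  set E := energyNormW L (k + 1) Us X (periodBox (d := d) (N * L ^ (k + 1))) ^ 2 with hEdef
  -- criticality on the tangent part `X_T ∈ T_♮(U♯) ⊆ T(U♯)`
  have hcritXT : dAction Us XT (perWin d (N * L ^ (k + 1))) = 0 := by
    obtain ⟨hYs, hYP, hYT, -, -⟩ := hXT
    have hYP' : IsPeriodicDir XT ((N * L ^ (k + 1) : ℕ) : ℤ) := by rw [← tower_eq L N (k + 1)]; exact hYP
    have hYT' : TangentIter L k Us XT := by simpa using hYT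
    exact hcritT XT hYs hYP' hYT'
  -- the weighted size 1, squared, and the weighted Poincaré letter
  have hNw2 : energyNormW L (k + 1) Us XN (periodBox (d := d) (N * L ^ (k + 1))) ^ 2 ≤ ν ^ 2 * E := by
    have h0 := energyNormW_nonneg L (k + 1) Us XN (periodBox (d := d) (N * L ^ (k + 1)))
    calc energyNormW L (k + 1) Us XN (periodBox (d := d) (N * L ^ (k + 1))) ^ 2
        ≤ (ν * energyNormW L (k + 1) Us X (periodBox (d := d) (N * L ^ (k + 1)))) ^ 2 := pow_le_pow_left₀ h0 hNw 2
      _ = ν ^ 2 * E := by rw [hEdef]; ring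
  have hm := curlSq_ge_weighted hCP.le (hP k Us hmem.1) hsplit hXT hNw2
  -- the radius along the segment and the slop from tangent criticality
  have hrad : ∀ t ∈ Icc (0 : ℝ) 1, SmallField (vary Us X t) (a + 7 * α ^ 2) := fun t ht =>
    smallField_vary_segment_class hUs hXs hUsa h1 hXα ht
  have ha' : 0 ≤ a + 7 * α ^ 2 := add_nonneg ha (mul_nonneg (by norm_num) (sq_nonneg α))
  have hslop : -(κ₁ * E) ≤ dAction Us X (plaqsOf (periodBox (d := d) (N * L ^ (k + 1)))) := by
    have h := dAction_ge_of_tangent_critical hUs hUsa hsplit hXNs (perWin d (N * L ^ (k + 1))) hcritXT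
    rw [e] at h hN1
    linarith
  -- the action comparison on the fine window from the level actions
  have hw : 0 < ((stepWt d L)⁻¹) ^ (k + 1) := pow_pos (inv_pos.mpr (stepWt_pos (d := d) L hL)) _
  have hfine : fineAction (vary Us X 1) (plaqsOf (periodBox (d := d) (N * L ^ (k + 1))))
      ≤ fineAction Us (plaqsOf (periodBox (d := d) (N * L ^ (k + 1)))) := by
    have h := hle.trans hmin'
    unfold levelAction at h
    rw [e] at h
    exact le_of_mul_le_mul_left h hw
  have hE0 := energyNormW_sq_eq_zero_of_slop (k := k + 1) hL hM hUs hXs hXP hα hXα hm ha' hrad hslop hline hfine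
  have h0 := eq_zero_of_energyNormW_sq_eq_zero hL hM Us hXP hE0
  refine ⟨h0, ?_⟩
  rw [h0]
  exact vary_zero_dir Us 1

/-! ## §3 ALL-SMALL from REP_w with the gauge identity -/

/-- **A COMPETITOR GAUGE-EQUIVALENT TO `U♯` IS AS SMALL AS `U♯`**: `u` unitary, `U′^u = U♯` ⟹ (`SmallField U♯ r ⟹ SmallField U′ r`)
(plaquettes are conjugated; [tree] `BlockAverageCurrent.smallField_gaugeAct` with `u⁻¹`). [folklore] -/
theorem smallField_of_gaugeAct_eq [Nonempty n] {u : Site d → (Matrix n n ℂ)ˣ} (hu : IsUnitarySite u) {Us U' : Site d → Fin d → (Matrix n n ℂ)ˣ}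
    (hg : gaugeAct u U' = Us) {r : ℝ} (hUs : SmallField Us r) : SmallField U' r := by
  have h := smallField_gaugeAct (u := fun z => (u z)⁻¹) (isUnitarySite_inv hu) (U := gaugeAct u U') (by rw [hg]; exact hUs)
  rwa [gaugeAct_inv_gaugeAct] at h

/-- **ALL-SMALL FOR ONE COMPETITOR**: under the hypotheses of `vary_eq_self_of_tanCritical_repW` and the GAUGE IDENTITY `U′^u = U♯e^{X}` (`u` unitary),
`SmallField U♯ r₁ ⟹ SmallField U′ r₁`. [folklore] -/
theorem smallField_of_le_of_repW_gauge [Nonempty n] {L N k : ℕ} [NeZero L] [NeZero N] (hL : 1 ≤ L) (hN : 1 ≤ N) {ε CP : ℝ}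
    (hε : 0 ≤ ε) (hCP : 0 < CP)
    (hP : ∀ (j : ℕ) (W : Site d → Fin d → (Matrix n n ℂ)ˣ), W ∈ sfClass d L N ε (j + 1) →
      SlicePoincare L (j + 1) W (frameFreeBlockLandauW L N (j + 1) W) CP (periodBox (d := d) (N * L ^ (j + 1))))
    {V Us U' : Site d → Fin d → (Matrix n n ℂ)ˣ} (hmem : Us ∈ admissible (sfClass d L N ε) L (k + 1) V)
    (hcritT : ∀ φ : Site d → Fin d → Matrix n n ℂ, IsSkewDir φ → IsPeriodicDir φ ((N * L ^ (k + 1) : ℕ) : ℤ) → TangentIter L k Us φ →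
      dAction Us φ (perWin d (N * L ^ (k + 1))) = 0)
    (hmin' : levelAction d L N (k + 1) U' ≤ levelAction d L N (k + 1) Us)
    {u : Site d → (Matrix n n ℂ)ˣ} (hu : IsUnitarySite u)
    {X XT XN : Site d → Fin d → Matrix n n ℂ} {α ν κ₁ : ℝ} (hXs : IsSkewDir X) (hXP : IsPeriodicDir X ((N * L ^ (k + 1) : ℕ) : ℤ))
    (hα : 0 ≤ α) (hXα : ∀ x μ, ‖X x μ‖ ≤ α) (hgauge : gaugeAct u U' = vary Us X 1) (hsplit : X = XT + XN)
    (hXT : XT ∈ frameFreeBlockLandauW (d := d) (n := n) L N (k + 1) Us) (hXNs : IsSkewDir XN)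
    (hNw : energyNormW L (k + 1) Us XN (periodBox (d := d) (N * L ^ (k + 1)))
      ≤ ν * energyNormW L (k + 1) Us X (periodBox (d := d) (N * L ^ (k + 1))))
    (hN1 : ε / ((L : ℝ) ^ (k + 1)) ^ 2 * (∑ p ∈ perWin d (N * L ^ (k + 1)), ‖curl Us XN p‖)
      ≤ κ₁ * energyNormW L (k + 1) Us X (periodBox (d := d) (N * L ^ (k + 1))) ^ 2)
    (hline : 2 * κ₁ < ((((1 / 2 - ν ^ 2) / (2 * (1 + CP)) - ν ^ 2) / 2
        - 576 * d * (Real.exp α - 1) ^ 2 * ((L : ℝ) ^ (k + 1)) ^ 2) / (Fintype.card n : ℝ)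
        - 28 * d * (ε / ((L : ℝ) ^ (k + 1)) ^ 2 + 7 * α ^ 2) * ((L : ℝ) ^ (k + 1)) ^ 2))
    (hU' : U' ∈ admissible (sfClass d L N ε) L (k + 1) V) {r₁ : ℝ} (hUsr : SmallField Us r₁) : SmallField U' r₁ := by
  -- the gauge identity gives the action equality and the class radius of the representative
  have hle : levelAction d L N (k + 1) (vary Us X 1) ≤ levelAction d L N (k + 1) U' := by
    rw [← hgauge, levelAction_gaugeAct]
  have h1 : SmallField (vary Us X 1) (ε / ((L : ℝ) ^ (k + 1)) ^ 2) := by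
    rw [← hgauge]
    exact smallField_gaugeAct hu hU'.1.2.2
  obtain ⟨-, hself⟩ := vary_eq_self_of_tanCritical_repW hL hN hε hCP hP hmem hcritT hmin' hXs hXP hα hXα hle h1 hsplit hXT hXNs hNw hN1 hline
  rw [hself] at hgauge
  exact smallField_of_gaugeAct_eq hu hgauge hUsr

/-- **ALL-SMALL ON THE CLASS (the letter of F27's minimisation road, DISCHARGED modulo REP_w with the gauge identity).**  `U♯ ∈ admissible (sfClass d L N ε)
L (k+1) V` critical on `T(U♯)`, `SmallField U♯ r₁`, (P♮)_W with constant `CP`; every admissible `U′` represented over `U♯` WITH THE GAUGE IDENTITY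
`U′^u = U♯e^X` and F9's weighted letters under the STRICT line ⟹ every admissible `U′` with `levelAction U′ ≤ levelAction U♯` is `SmallField · r₁`
(indeed gauge-equivalent to `U♯`). [folklore] -/
theorem allSmall_of_tanCritical_repW_gauge [Nonempty n] {L N k : ℕ} [NeZero L] [NeZero N] (hL : 1 ≤ L) (hN : 1 ≤ N) {ε CP : ℝ}
    (hε : 0 ≤ ε) (hCP : 0 < CP)
    (hP : ∀ (j : ℕ) (W : Site d → Fin d → (Matrix n n ℂ)ˣ), W ∈ sfClass d L N ε (j + 1) →
      SlicePoincare L (j + 1) W (frameFreeBlockLandauW L N (j + 1) W) CP (periodBox (d := d) (N * L ^ (j + 1))))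
    {V Us : Site d → Fin d → (Matrix n n ℂ)ˣ} (hmem : Us ∈ admissible (sfClass d L N ε) L (k + 1) V)
    (hcritT : ∀ φ : Site d → Fin d → Matrix n n ℂ, IsSkewDir φ → IsPeriodicDir φ ((N * L ^ (k + 1) : ℕ) : ℤ) → TangentIter L k Us φ →
      dAction Us φ (perWin d (N * L ^ (k + 1))) = 0)
    (hrep : ∀ U' ∈ admissible (sfClass d L N ε) L (k + 1) V, ∃ (u : Site d → (Matrix n n ℂ)ˣ) (X XT XN : Site d → Fin d → Matrix n n ℂ)
      (α ν κ₁ : ℝ), IsUnitarySite u ∧ IsSkewDir X ∧ IsPeriodicDir X ((N * L ^ (k + 1) : ℕ) : ℤ) ∧ 0 ≤ α ∧ (∀ x μ, ‖X x μ‖ ≤ α) ∧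
      gaugeAct u U' = vary Us X 1 ∧
      X = XT + XN ∧ XT ∈ frameFreeBlockLandauW (d := d) (n := n) L N (k + 1) Us ∧ IsSkewDir XN ∧ 0 ≤ ν ∧
      energyNormW L (k + 1) Us XN (periodBox (d := d) (N * L ^ (k + 1)))
        ≤ ν * energyNormW L (k + 1) Us X (periodBox (d := d) (N * L ^ (k + 1))) ∧
      ε / ((L : ℝ) ^ (k + 1)) ^ 2 * (∑ p ∈ perWin d (N * L ^ (k + 1)), ‖curl Us XN p‖)
        ≤ κ₁ * energyNormW L (k + 1) Us X (periodBox (d := d) (N * L ^ (k + 1))) ^ 2 ∧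
      2 * κ₁ < ((((1 / 2 - ν ^ 2) / (2 * (1 + CP)) - ν ^ 2) / 2
          - 576 * d * (Real.exp α - 1) ^ 2 * ((L : ℝ) ^ (k + 1)) ^ 2) / (Fintype.card n : ℝ)
          - 28 * d * (ε / ((L : ℝ) ^ (k + 1)) ^ 2 + 7 * α ^ 2) * ((L : ℝ) ^ (k + 1)) ^ 2))
    {r₁ : ℝ} (hUsr : SmallField Us r₁) :
    ∀ U' ∈ admissible (sfClass d L N ε) L (k + 1) V, levelAction d L N (k + 1) U' ≤ levelAction d L N (k + 1) Us → SmallField U' r₁ := by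
  intro U' hU' hmin'
  obtain ⟨u, X, XT, XN, α, ν, κ₁, hu, hXs, hXP, hα, hXα, hgauge, hsplit, hXT, hXNs, -, hNw, hN1, hline⟩ := hrep U' hU'
  exact smallField_of_le_of_repW_gauge hL hN hε hCP hP hmem hcritT hmin' hu hXs hXP hα hXα hgauge hsplit hXT hXNs hNw hN1 hline hU' hUsr

/-- **HENCE ALSO CONV** (the non-strict consequence, for the record): under the same REP_w-with-gauge hypothesis `U♯` IS a minimiser — F19's
`isMinimiser_of_tanCritical_repW_class`, its `hrep` read off the gauge identity (`levelAction` and the class radius are gauge invariant). [folklore] -/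
theorem isMinimiser_of_tanCritical_repW_gauge [Nonempty n] {L N k : ℕ} [NeZero L] [NeZero N] (hL : 1 ≤ L) (hN : 1 ≤ N) {ε CP : ℝ}
    (hε : 0 ≤ ε) (hCP : 0 < CP)
    (hP : ∀ (j : ℕ) (W : Site d → Fin d → (Matrix n n ℂ)ˣ), W ∈ sfClass d L N ε (j + 1) →
      SlicePoincare L (j + 1) W (frameFreeBlockLandauW L N (j + 1) W) CP (periodBox (d := d) (N * L ^ (j + 1))))
    {V Us : Site d → Fin d → (Matrix n n ℂ)ˣ} (hmem : Us ∈ admissible (sfClass d L N ε) L (k + 1) V)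
    (hcritT : ∀ φ : Site d → Fin d → Matrix n n ℂ, IsSkewDir φ → IsPeriodicDir φ ((N * L ^ (k + 1) : ℕ) : ℤ) → TangentIter L k Us φ →
      dAction Us φ (perWin d (N * L ^ (k + 1))) = 0)
    (hrep : ∀ U' ∈ admissible (sfClass d L N ε) L (k + 1) V, ∃ (u : Site d → (Matrix n n ℂ)ˣ) (X XT XN : Site d → Fin d → Matrix n n ℂ)
      (α ν κ₁ : ℝ), IsUnitarySite u ∧ IsSkewDir X ∧ IsPeriodicDir X ((N * L ^ (k + 1) : ℕ) : ℤ) ∧ 0 ≤ α ∧ (∀ x μ, ‖X x μ‖ ≤ α) ∧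
      gaugeAct u U' = vary Us X 1 ∧
      X = XT + XN ∧ XT ∈ frameFreeBlockLandauW (d := d) (n := n) L N (k + 1) Us ∧ IsSkewDir XN ∧ 0 ≤ ν ∧
      energyNormW L (k + 1) Us XN (periodBox (d := d) (N * L ^ (k + 1)))
        ≤ ν * energyNormW L (k + 1) Us X (periodBox (d := d) (N * L ^ (k + 1))) ∧
      ε / ((L : ℝ) ^ (k + 1)) ^ 2 * (∑ p ∈ perWin d (N * L ^ (k + 1)), ‖curl Us XN p‖)
        ≤ κ₁ * energyNormW L (k + 1) Us X (periodBox (d := d) (N * L ^ (k + 1))) ^ 2 ∧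
      2 * κ₁ < ((((1 / 2 - ν ^ 2) / (2 * (1 + CP)) - ν ^ 2) / 2
          - 576 * d * (Real.exp α - 1) ^ 2 * ((L : ℝ) ^ (k + 1)) ^ 2) / (Fintype.card n : ℝ)
          - 28 * d * (ε / ((L : ℝ) ^ (k + 1)) ^ 2 + 7 * α ^ 2) * ((L : ℝ) ^ (k + 1)) ^ 2)) :
    IsMinimiser d (sfClass d L N ε) L N (k + 1) V Us := by
  refine NE7ConvOneStepTangent.isMinimiser_of_tanCritical_repW_class hL hN hε hCP hP hmem hcritT fun U' hU' => ?_
  obtain ⟨u, X, XT, XN, α, ν, κ₁, hu, hXs, hXP, hα, hXα, hgauge, hsplit, hXT, hXNs, hν, hNw, hN1, hline⟩ := hrep U' hU'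
  refine ⟨X, XT, XN, α, ν, κ₁, hXs, hXP, hα, hXα, ?_, ?_, hsplit, hXT, hXNs, hν, hNw, hN1, hline.le⟩
  · rw [← hgauge, levelAction_gaugeAct]
  · rw [← hgauge]
    exact smallField_gaugeAct hu hU'.1.2.2

end

end Summit.QuantumFields.BalabanUV.T4Continuum.NE7ConvOneStepWeightedUnique
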